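import Summits.Ventures.PercRepro.C041StarBoundsTwo

/-!
# STAR BOUNDS III — `B ≤ (1 − A)²` for stars with at least two leaves (mine-3, gen 64; C-041.md §21 (ay) addendum 2)

Every factor `1 − a j` of `B = ∏ (1 − a i)` is at most `1 − A` (because `A = ∏ a i ≤ a j`), so with two or more factors in
`[0, 1]`, `B ≤ (1 − A)²`; the mirror `A ≤ (1 − B)²`.  This is the inequality the P₁ → ∞ tail of the lower-frontier reduction
needs: on the hyperbola `P₂ = 1 + κ(1 − A)²/P₁` the conditions of the L₁ certificate (`InCone_thetaTri_v1_of_L1`) fail only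
where `B` is comparable to `(1 − A)·P₁⁻¹` with `A → 1`, which `B ≤ (1 − A)²` excludes.
-/

namespace PercRepro

namespace TreeClosure

open Finset

/-- Each factor `1 − a j` is at most `1 − A`. -/
theorem one_sub_le_one_sub_prod {m : ℕ} (a : Fin m → ℝ) (ha : ∀ i, 0 ≤ a i ∧ a i ≤ 1) (j : Fin m) :
    1 - a j ≤ 1 - ∏ i, a i := by
  have h : ∏ i, a i ≤ a j := by
    calc ∏ i, a i = a j * ∏ i ∈ Finset.univ.erase j, a i := (Finset.mul_prod_erase _ _ (Finset.mem_univ j)).symm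
      _ ≤ a j * 1 := by
        apply mul_le_mul_of_nonneg_left _ (ha j).1
        exact Finset.prod_le_one (fun i _ => (ha i).1) (fun i _ => (ha i).2)
      _ = a j := mul_one _
  linarith

/-- `B ≤ (1 − A)²` for a star with at least two leaves. -/
theorem prod_one_sub_le_sq_one_sub_prod {m : ℕ} (a : Fin (m + 2) → ℝ) (ha : ∀ i, 0 ≤ a i ∧ a i ≤ 1) :
    ∏ i, (1 - a i) ≤ (1 - ∏ i, a i) ^ 2 := by
  have hsplit : ∏ i, (1 - a i) = (1 - a 0) * ((1 - a 1) * ∏ i : Fin m, (1 - a i.succ.succ)) := by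
    rw [Fin.prod_univ_succ, Fin.prod_univ_succ]
    rfl
  have h2 : ∏ i : Fin m, (1 - a i.succ.succ) ≤ 1 :=
    Finset.prod_le_one (fun i _ => by linarith [(ha i.succ.succ).2]) (fun i _ => by linarith [(ha i.succ.succ).1])
  have h0 : 0 ≤ 1 - a 0 := by linarith [(ha 0).2]
  have h1 : 0 ≤ 1 - a 1 := by linarith [(ha 1).2]
  have hA : 0 ≤ 1 - ∏ i, a i := by linarith [(prod_unit_mem a ha).2]
  rw [hsplit]
  calc (1 - a 0) * ((1 - a 1) * ∏ i : Fin m, (1 - a i.succ.succ)) ≤ (1 - a 0) * ((1 - a 1) * 1) := by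
        apply mul_le_mul_of_nonneg_left _ h0
        exact mul_le_mul_of_nonneg_left h2 h1
    _ = (1 - a 0) * (1 - a 1) := by ring
    _ ≤ (1 - ∏ i, a i) * (1 - ∏ i, a i) :=
        mul_le_mul (one_sub_le_one_sub_prod a ha 0) (one_sub_le_one_sub_prod a ha 1) h1 hA
    _ = (1 - ∏ i, a i) ^ 2 := by ring

/-- `A ≤ (1 − B)²` for a star with at least two leaves (the mirror). -/
theorem prod_le_sq_one_sub_prod_one_sub {m : ℕ} (a : Fin (m + 2) → ℝ) (ha : ∀ i, 0 ≤ a i ∧ a i ≤ 1) :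
    ∏ i, a i ≤ (1 - ∏ i, (1 - a i)) ^ 2 := by
  have h := prod_one_sub_le_sq_one_sub_prod (fun i => 1 - a i) (fun i => ⟨by linarith [(ha i).2], by linarith [(ha i).1]⟩)
  simpa only [sub_sub_cancel] using h

end TreeClosure

end PercRepro
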